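import Summits.RiemannHypothesis.RiemannHypothesis.Theorems.JensenLogBandArcHalfAnnulus
import Summits.RiemannHypothesis.RiemannHypothesis.Theorems.JensenLogBandArcSaddlePolar
import Mathlib.Analysis.Calculus.MeanValue
import Mathlib.MeasureTheory.Integral.CircleIntegral
import HarnessLib

/-!
# The `φ`-derivative of `log ‖·‖` along the saddle arc (BAND line, step S4c — the estimate)

RH ladder column JENSEN, rung J-P(P3) «log band», BAND crux `XiDerivBandRealAllRates` of route
«JensenLogBand», line «band-one-window» (u-arc reshape), lead rh-jensen-prover g7 — the heart of
step (S4c) «global descent» of HOME/rh-jensen-prover/g7-work/LINE-PLAN.md §8.2. RH-FREE (Γ-factor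
only). WHAT THIS IS NOT: nothing here bears on zeros of `ζ` or the truth of RH.

On the arc `u(φ) = c + r e^{iφ}` through the saddle `u* = u(φ₀)` (`r = ‖u* − c‖`,
`φ₀ = arg(u* − c)`), eng-2 g5's `hasDerivAt_log_norm_arcModelIntegrand` gives
`d/dφ log‖arcModelIntegrand n r c φ‖ = Re(i(u−c)·S_{n,c}(u))`, and
`Re(i(u−c)S(u)) = −r(sin φ·Re D(u) + cos φ·Im D(u))` (`re_I_mul_sub_mul_arcSaddleFn`). Since
`D(u*) = n/(u* − c) = (n/r)e^{−iφ₀}` EXACTLY (`sub_eq_div_saddleDen_of_arcSaddleFn_eq_zero`),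
`sin φ·Re D(u*) + cos φ·Im D(u*) = (n/r)·sin(φ − φ₀)` (`saddle_trig_identity`), and `D` is
`M`-Lipschitz along the arc (`norm_saddleDen_sub_le_arc`, `M = 11.21/T + 1/(0.58T)² + (n+1)/(1.58T)²`
from `hasDerivAt_saddleDen_halfAnnulus`). Hence (`descent_deriv_estimate`)

  `|Re(i(u(φ)−c)·S(u(φ))) + n·sin(φ − φ₀)| ≤ M r²·|φ − φ₀|`,   `|φ| ≤ π/2`,

with `M r² ≤ (10/ℓ_T + 1/16)·(n+1)` — i.e. `d/dφ log‖I‖ = −n sin(φ−φ₀)(1 + O(1/ℓ + τ²))`: the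
modulus of the `ζ`-free integrand falls off the saddle like `exp(−n(1 − cos(φ−φ₀)))` along the
whole right half-arc once `ℓ_T ≥ ℓ₀` (free by `band_regime`). The integration (monotonicity of
`log‖I(φ₀ ± ψ)‖ + κnψ²`) is left to the S4c assembly file.
-/

noncomputable section

-- single-problem summit: `Summit.RiemannHypothesis.RiemannHypothesis.…` is the tree convention
set_option linter.dupNamespace false

open Complex Real Set

namespace Summit.RiemannHypothesis.RiemannHypothesis.Theorems.JensenPolynomials.LogBandArc

open Literature.NumberTheory.LFunctions

variable {n : ℕ} {x T r : ℝ} {u : ℂ}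

/-- Points of the arc `c + r e^{iφ}`, `|φ| ≤ π/2`, `r > 0`: `Re(u − c) = r cos φ ≥ 0`,
`Im(u − c) = r sin φ`, `‖u − c‖ = r`. [folklore] -/
theorem circleMap_sub_re_im (c : ℂ) (r φ : ℝ) :
    (circleMap c r φ - c).re = r * Real.cos φ ∧ (circleMap c r φ - c).im = r * Real.sin φ := by
  rw [circleMap_sub_center, circleMap_zero]
  constructor
  · simp [Complex.mul_re, Complex.exp_ofReal_mul_I_re, Complex.exp_ofReal_mul_I_im]
  · simp [Complex.mul_im, Complex.exp_ofReal_mul_I_re, Complex.exp_ofReal_mul_I_im]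

/-- **`D` is `M r`-Lipschitz in the angle along the arc** `c + r e^{iφ}`, `|φ| ≤ π/2`,
`0 < r ≤ (6/5) h`, with `M = 11.21/T + 1/(0.58T)² + (n+1)/(1.58T)²`. [folklore] -/
theorem norm_saddleDen_sub_le_arc (hx : |x| ≤ 1 / 2) (hT : 100 ≤ T)
    (hh : 1 / 2 ≤ bandRadius n T) (hhT : bandRadius n T ≤ 7 / 20 * T) (hr : 0 < r)
    (hrh : r ≤ 6 / 5 * bandRadius n T) {φ φ' : ℝ} (hφ : φ ∈ Icc (-(π / 2)) (π / 2))
    (hφ' : φ' ∈ Icc (-(π / 2)) (π / 2)) :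
    ‖saddleDen n ((x : ℂ) + (T : ℂ) * I) (circleMap ((x : ℂ) + (T : ℂ) * I) r φ) -
        saddleDen n ((x : ℂ) + (T : ℂ) * I) (circleMap ((x : ℂ) + (T : ℂ) * I) r φ')‖ ≤
      (1121 / 100 / T + 1 / (29 / 50 * T) ^ 2 + ((n : ℝ) + 1) / (79 / 50 * T) ^ 2) * r *
        |φ - φ'| := by
  set c : ℂ := (x : ℂ) + (T : ℂ) * I with hc
  set M : ℝ := 1121 / 100 / T + 1 / (29 / 50 * T) ^ 2 + ((n : ℝ) + 1) / (79 / 50 * T) ^ 2 with hM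
  -- derivative of `t ↦ D(c + r e^{it})` on the arc, with norm ≤ M r
  have hderiv : ∀ t ∈ Icc (-(π / 2)) (π / 2), ∃ f' : ℂ,
      HasDerivAt (fun t : ℝ => saddleDen n c (circleMap c r t)) f' t ∧ ‖f'‖ ≤ M * r := by
    intro t ht
    have hcos : 0 ≤ Real.cos t := Real.cos_nonneg_of_mem_Icc ht
    obtain ⟨hre_t, him_t⟩ := circleMap_sub_re_im c r t
    have hure : 0 ≤ (circleMap c r t - c).re := by rw [hre_t]; positivity
    have hur : ‖circleMap c r t - c‖ ≤ 6 / 5 * bandRadius n T := by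
      rw [circleMap_sub_center, norm_circleMap_zero, abs_of_pos hr]; exact hrh
    obtain ⟨D', hD', hb⟩ := hasDerivAt_saddleDen_halfAnnulus hx hT hh hhT hure hur
    have hcm := hasDerivAt_circleMap c r t
    refine ⟨D' * (circleMap 0 r t * I), hD'.comp t hcm, ?_⟩
    rw [norm_mul, norm_mul, norm_circleMap_zero, Complex.norm_I, mul_one, abs_of_pos hr]
    exact mul_le_mul_of_nonneg_right hb hr.le
  choose! F hF using hderiv
  have key := Convex.norm_image_sub_le_of_norm_hasDerivWithin_le
    (f := fun t : ℝ => saddleDen n c (circleMap c r t)) (s := Icc (-(π / 2)) (π / 2))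
    (fun t ht => (hF t ht).1.hasDerivWithinAt) (fun t ht => (hF t ht).2) (convex_Icc _ _) hφ' hφ
  have e : ‖φ - φ'‖ = |φ - φ'| := Real.norm_eq_abs _
  rw [e] at key
  simpa [mul_assoc] using key

/-- **The trigonometric identity at the saddle:** if `u* − c = n/D*` (`n ≠ 0`), `r = ‖u* − c‖`,
`φ₀ = arg(u* − c)`, then `sin φ · Re D* + cos φ · Im D* = (n/r)·sin(φ − φ₀)`. [folklore] -/
theorem saddle_trig_identity {w Dstar : ℂ} (hn : n ≠ 0) (hw : w = (n : ℂ) / Dstar) (hw0 : w ≠ 0)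
    (φ : ℝ) :
    Real.sin φ * Dstar.re + Real.cos φ * Dstar.im = (n : ℝ) / ‖w‖ * Real.sin (φ - Complex.arg w) := by
  have hD0 : Dstar ≠ 0 := by
    intro h0; rw [h0, div_zero] at hw; exact hw0 hw
  have hn0 : (n : ℂ) ≠ 0 := by exact_mod_cast hn
  -- `Dstar = n / w = (n/‖w‖) e^{-i arg w}`
  have hDw : Dstar = (n : ℂ) / w := by rw [hw]; field_simp
  have hpolar : w = (‖w‖ : ℂ) * Complex.exp (Complex.arg w * I) := (Complex.norm_mul_exp_arg_mul_I w).symm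
  have hnw : (‖w‖ : ℂ) ≠ 0 := by exact_mod_cast (norm_ne_zero_iff.2 hw0)
  have hD : Dstar = ((n : ℝ) / ‖w‖ : ℝ) * Complex.exp (-(Complex.arg w * I)) := by
    rw [hDw, Complex.exp_neg]
    nth_rewrite 1 [hpolar]
    push_cast
    field_simp
  have hneg : -((Complex.arg w : ℂ) * I) = ((-Complex.arg w : ℝ) : ℂ) * I := by push_cast; ring
  have hre : Dstar.re = (n : ℝ) / ‖w‖ * Real.cos (Complex.arg w) := by
    rw [hD, Complex.re_ofReal_mul, hneg, Complex.exp_ofReal_mul_I_re, Real.cos_neg]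
  have him : Dstar.im = -((n : ℝ) / ‖w‖ * Real.sin (Complex.arg w)) := by
    rw [hD, Complex.im_ofReal_mul, hneg, Complex.exp_ofReal_mul_I_im, Real.sin_neg]
    ring
  rw [hre, him, Real.sin_sub]
  ring

/-- `|cos φ · b + sin φ · a| ≤ ‖a + bi‖`-type bound: `|sin φ · Re z + cos φ · Im z| ≤ ‖z‖`. [folklore] -/
theorem abs_sin_mul_re_add_cos_mul_im_le (φ : ℝ) (z : ℂ) :
    |Real.sin φ * z.re + Real.cos φ * z.im| ≤ ‖z‖ := by
  rw [abs_le]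
  have h1 := Real.sin_sq_add_cos_sq φ
  have h2 : ‖z‖ ^ 2 = z.re ^ 2 + z.im ^ 2 := by
    rw [← Complex.normSq_eq_norm_sq, Complex.normSq_apply]; ring
  have h0 : 0 ≤ ‖z‖ := norm_nonneg z
  constructor <;>
    nlinarith [sq_nonneg (Real.sin φ * z.im - Real.cos φ * z.re),
      sq_nonneg (Real.sin φ * z.re + Real.cos φ * z.im + ‖z‖),
      sq_nonneg (Real.sin φ * z.re + Real.cos φ * z.im - ‖z‖), sq_abs (Real.sin φ * z.re + Real.cos φ * z.im)]

/-- **The descent derivative estimate (S4c).** Let `u*` be a zero of `S_{n,c}` in the disc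
(`exists_arcSaddleFn_eq_zero`), `r = ‖u* − c‖`, `φ₀ = arg(u* − c)`, and `u = c + r e^{iφ}` with
`|φ| ≤ π/2`, `Re(½+u) > 0`, `½ + u ≠ 1`. Then
`|Re(i(u−c)·S_{n,c}(u)) + n·sin(φ − φ₀)| ≤ M r²·|φ − φ₀|`,
`M = 11.21/T + 1/(0.58T)² + (n+1)/(1.58T)²`. [folklore] -/
theorem descent_deriv_estimate {ustar : ℂ} (hx : |x| ≤ 1 / 2) (hT : 100 ≤ T) (hℓ : 20 ≤ ell T)
    (hn : 100 ≤ n) (hh : 1 / 2 ≤ bandRadius n T) (hhT : bandRadius n T ≤ 7 / 20 * T)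
    (hustar : ‖ustar - ((x : ℂ) + (T : ℂ) * I + bandRadius n T)‖ ≤ 3 / 5 * bandRadius n T)
    (hS : arcSaddleFn n ((x : ℂ) + (T : ℂ) * I) ustar = 0) {φ : ℝ}
    (hφ : φ ∈ Icc (-(π / 2)) (π / 2))
    (hre : 0 < (1 / 2 + circleMap ((x : ℂ) + (T : ℂ) * I) ‖ustar - ((x : ℂ) + (T : ℂ) * I)‖ φ).re)
    (h1 : 1 / 2 + circleMap ((x : ℂ) + (T : ℂ) * I) ‖ustar - ((x : ℂ) + (T : ℂ) * I)‖ φ ≠ 1) :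
    |(I * (circleMap ((x : ℂ) + (T : ℂ) * I) ‖ustar - ((x : ℂ) + (T : ℂ) * I)‖ φ -
          ((x : ℂ) + (T : ℂ) * I)) *
        arcSaddleFn n ((x : ℂ) + (T : ℂ) * I)
          (circleMap ((x : ℂ) + (T : ℂ) * I) ‖ustar - ((x : ℂ) + (T : ℂ) * I)‖ φ)).re +
        (n : ℝ) * Real.sin (φ - Complex.arg (ustar - ((x : ℂ) + (T : ℂ) * I)))| ≤
      (1121 / 100 / T + 1 / (29 / 50 * T) ^ 2 + ((n : ℝ) + 1) / (79 / 50 * T) ^ 2) *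
        ‖ustar - ((x : ℂ) + (T : ℂ) * I)‖ ^ 2 *
        |φ - Complex.arg (ustar - ((x : ℂ) + (T : ℂ) * I))| := by
  set c : ℂ := (x : ℂ) + (T : ℂ) * I with hc
  set w : ℂ := ustar - c with hw
  set r : ℝ := ‖w‖ with hr
  set φ₀ : ℝ := Complex.arg w with hφ₀
  set M : ℝ := 1121 / 100 / T + 1 / (29 / 50 * T) ^ 2 + ((n : ℝ) + 1) / (79 / 50 * T) ^ 2 with hM
  set u : ℂ := circleMap c r φ with hu
  have hℓ0 : 0 < ell T := by linarith
  obtain ⟨hre_pos, -, -, -, hr_hi⟩ := arcSaddle_polar_bounds hx hT hℓ hn hh hhT hustar hS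
  have hw0 : w ≠ 0 := by
    intro h0
    have h' : (0 : ℝ) < w.re := hre_pos
    rw [h0] at h'
    simp at h'
  have hr0 : 0 < r := norm_pos_iff.2 hw0
  have hhℓ : bandRadius n T * ell T = 2 * ((n : ℝ) + 1) := bandRadius_mul_ell hℓ
  have hrh : r ≤ 6 / 5 * bandRadius n T := by
    have h1 : r ≤ 20 / 9 * ((n : ℝ) / ell T) := hr_hi
    have h2 : (n : ℝ) / ell T ≤ bandRadius n T / 2 := by
      rw [div_le_iff₀ hℓ0]; nlinarith
    linarith
  -- the saddle as a point of the arc: `w = r e^{iφ₀}`, `|φ₀| < π/2`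
  have hφ₀mem : φ₀ ∈ Icc (-(π / 2)) (π / 2) := by
    have := (Complex.abs_arg_lt_pi_div_two_iff.2 (Or.inl hre_pos))
    rw [abs_lt] at this
    exact ⟨this.1.le, this.2.le⟩
  have hustar_eq : ustar = circleMap c r φ₀ := by
    rw [circleMap, hr, hφ₀, Complex.norm_mul_exp_arg_mul_I w, hw]
    ring
  -- `D(u) = D* + Δ`, `‖Δ‖ ≤ M r |φ − φ₀|`
  have hΔ := norm_saddleDen_sub_le_arc hx hT hh hhT hr0 hrh hφ hφ₀mem
  rw [← hustar_eq] at hΔ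
  set Δ : ℂ := saddleDen n c u - saddleDen n c ustar with hΔdef
  -- `D* = n / w`
  have hDstar : w = (n : ℂ) / saddleDen n c ustar :=
    sub_eq_div_saddleDen_of_arcSaddleFn_eq_zero hx hT hℓ hn hh hhT hustar hS
  have hn0 : n ≠ 0 := by omega
  have htrig := saddle_trig_identity hn0 hDstar hw0 φ
  -- the derivative expression
  have huc : u ≠ c := by
    intro h0
    have : ‖u - c‖ = r := by rw [hu, circleMap_sub_center, norm_circleMap_zero, abs_of_pos hr0]
    rw [h0, sub_self, norm_zero] at this
    linarith
  rw [re_I_mul_sub_mul_arcSaddleFn n c hre h1 huc]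
  obtain ⟨hure, huim⟩ := circleMap_sub_re_im c r φ
  rw [hure, huim]
  have hsplit : saddleDen n c u = saddleDen n c ustar + Δ := by rw [hΔdef]; ring
  rw [hsplit, Complex.add_re, Complex.add_im]
  -- main term cancels against `n sin(φ − φ₀)` by the trig identity; error ≤ r ‖Δ‖
  have e : -(r * Real.cos φ * ((saddleDen n c ustar).im + Δ.im) +
        r * Real.sin φ * ((saddleDen n c ustar).re + Δ.re)) + (n : ℝ) * Real.sin (φ - φ₀) =
      -(r * (Real.sin φ * (saddleDen n c ustar).re + Real.cos φ * (saddleDen n c ustar).im)) +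
        (n : ℝ) * Real.sin (φ - φ₀) - r * (Real.sin φ * Δ.re + Real.cos φ * Δ.im) := by ring
  rw [e, htrig]
  have e2 : -(r * ((n : ℝ) / ‖w‖ * Real.sin (φ - Complex.arg w))) + (n : ℝ) * Real.sin (φ - φ₀) = 0 := by
    rw [← hr, ← hφ₀]; field_simp; ring
  rw [e2, zero_sub, abs_neg, abs_mul, abs_of_pos hr0]
  have hB := abs_sin_mul_re_add_cos_mul_im_le φ Δ
  calc r * |Real.sin φ * Δ.re + Real.cos φ * Δ.im| ≤ r * ‖Δ‖ := mul_le_mul_of_nonneg_left hB hr0.le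
    _ ≤ r * (M * r * |φ - φ₀|) := mul_le_mul_of_nonneg_left hΔ hr0.le
    _ = M * r ^ 2 * |φ - φ₀| := by ring

end Summit.RiemannHypothesis.RiemannHypothesis.Theorems.JensenPolynomials.LogBandArc

end
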